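import Literature.MathematicalPhysics.QuantumFieldTheory.Balaban1983to89.B3Op116CollarSources
import Literature.MathematicalPhysics.QuantumFieldTheory.Balaban1983to89.B1Ineq225RegularBox

/-!
# Bałaban, *(Higgs)₂,₃ quantum fields in a finite volume III* [B3] — the FACE FAMILY of a cell-product box for the located Leibniz row of
the collar operator (Route δ, class (c) of p. 433) — file «CollarBoxFaces»

statement-level skeleton of published theorems with citation tags; proofs where landed; nothing here is a claim about the Yang–Mills mass gap

T. Bałaban, Commun. Math. Phys. **88** (1983) 411–445 [cite: Balaban1983Higgs3], p. 433 [PDF 23] (class (c); verbatim: *"We assume that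
□₁, □ are sums of big blocks of the unit lattice"* — the box on which the collar operator of the cell's Route δ lives, HOME/GAPS.md G-B3-16.A1;
the bonds of the collar part crossing `∂□` end on the faces of the box — this file's content, not a printed sentence); part I
[cite: Balaban1982Higgs1], Prop. 2.1 p. 611 l.1–2 («rectangular parallelepiped» of large blocks).

CITATION HEADER (lean-in-tree rule).  Cell `lit-balaban`, Phase-2 proof seat **p40** gen 77 (unit `lit-balaban-p40`); free-target protocol
G.5-34(d), TAKING line HOME/STATUS.md 2026-08-23T12:41:06Z (cc r15 = owner of rows B3.Txt@433 / B3.Eq1.16, p35).  Design note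
`lit-balaban-p40/DESIGN-B3-116-box.md` §8.3 item 2 (configuration plug: the face family of a box).  USED BY NAME: p40's
`B3Op116CollarSources.{exB, enB, mem_exB, mem_enB}` (p367355), gen 12's `B1Ineq225RegularBox.{cellBox, cellOf, mem_cellBox}`, the typer's
`B1TorusChainTransport.{shift_apply_self, shift_apply_ne}`.  No head claim.

## What this file provides

* `faces K K₀ S` — the family of coordinate slices `{z : z_ν = r}` through which a bond can LEAVE or ENTER the cell-product box
  `cellBox K K₀ S`: the pairs `(ν, r)` with `⌊r/M⌋ ∈ S_ν` and `⌊(r+1)/M⌋ ∉ S_ν` (exit) or `⌊(r−1)/M⌋ ∉ S_ν` (entry).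
* `sliceOf`, `faces_subset_image`, `card_faces_le` — every face slice is the first or the last site of a cell of the box, so `|faces| ≤ 2Σ_ν|S_ν|`.
* `exists_face_of_mem_exB` / `exists_face_of_mem_enB` — the hypotheses `hexF` / `henF` of p40's `B3Op116CollarHolder.holder_row_collar_le`
  and `B3Ineq25Op116CollarRegionHolder.ineq25At_one_zero_collarBox_holder` for `Ω = cellBox K K₀ S` and `Fc = faces K K₀ S`: a bond of the box
  whose forward neighbour leaves the box has its source on an exit slice in its own direction; a bond entering the box has its target on an entry
  slice.

## Honest scope

Pure lattice geometry, with the cardinality bound `|faces| ≤ 2Σ_ν|S_ν|` (`card_faces_le`; for an interval box of `m` cells per side `≤ 2dm`).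
Two `def`s (data, not `Prop`s), theorems; no `sorry`; axioms standard.  Value = a located member of a by-reference step of B3 — NOT summit
progress and nothing about the Yang–Mills mass gap.
-/

noncomputable section

namespace Literature.MathematicalPhysics.QuantumFieldTheory.Balaban1983to89.B3Op116CollarBoxFaces

open B1Ineq225RegularBox (cellBox cellOf mem_cellBox)
open B1TorusCubeCover (half)
open B1TorusChainTransport (shift_apply_self shift_apply_ne)
open B3Op116CollarSources (exB enB mem_exB mem_enB)
open B3Op116LeibnizRows (pred)

variable {P : HiggsLattice.Params}

section Faces

open scoped Classical

variable (K K₀ : ℕ)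

/-- **The face family of a cell-product box**: the coordinate slices `(ν, r)` with `⌊r/M⌋ ∈ S_ν` and (`⌊(r+1)/M⌋ ∉ S_ν` or `⌊(r−1)/M⌋ ∉ S_ν`),
`M = L^K K₀` — the slices carrying the endpoints in the box of the bonds crossing its boundary.
[cite: Balaban1982Higgs1, Prop. 2.1 p.611 l.1–2] [cite: Balaban1983Higgs3, p.433] -/
def faces (S : Fin P.d → Finset ℕ) : Finset (Σ ν : Fin P.d, ZMod (P.sitesPerDir 0 ν)) :=
  Finset.univ.filter fun f => f.2.val / half P K K₀ ∈ S f.1 ∧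
    ((f.2 + 1).val / half P K K₀ ∉ S f.1 ∨ (f.2 - 1).val / half P K K₀ ∉ S f.1)

variable {K K₀}

/-- Membership in the face family. [cite: Balaban1982Higgs1, Prop. 2.1 p.611 l.1–2] -/
theorem mem_faces {S : Fin P.d → Finset ℕ} {f : Σ ν : Fin P.d, ZMod (P.sitesPerDir 0 ν)} :
    f ∈ faces K K₀ S ↔ f.2.val / half P K K₀ ∈ S f.1 ∧
      ((f.2 + 1).val / half P K K₀ ∉ S f.1 ∨ (f.2 - 1).val / half P K K₀ ∉ S f.1) := by
  simp [faces]

/-- If `z ∈ □` and `z + e_ν ∉ □` then `(ν, z_ν)` is an exit slice. [cite: Balaban1982Higgs1, Prop. 2.1 p.611 l.1–2] -/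
theorem face_of_shift_not_mem {S : Fin P.d → Finset ℕ} {z : HiggsLattice.Site P 0} {ν : Fin P.d} (hz : z ∈ cellBox K K₀ S)
    (hz' : z.shift ν ∉ cellBox K K₀ S) : (⟨ν, z ν⟩ : Σ ν : Fin P.d, ZMod (P.sitesPerDir 0 ν)) ∈ faces K K₀ S := by
  rw [mem_cellBox] at hz hz'
  push Not at hz'
  obtain ⟨μ, hμ⟩ := hz'
  have hμν : μ = ν := by
    by_contra h
    exact hμ (by rw [cellOf, shift_apply_ne z h]; exact hz μ)
  subst hμν
  rw [cellOf, shift_apply_self] at hμ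
  exact mem_faces.2 ⟨hz μ, Or.inl hμ⟩

/-- If `z ∉ □` and `z + e_ν ∈ □` then `(ν, z_ν + 1)` is an entry slice. [cite: Balaban1982Higgs1, Prop. 2.1 p.611 l.1–2] -/
theorem face_of_not_mem_shift_mem {S : Fin P.d → Finset ℕ} {z : HiggsLattice.Site P 0} {ν : Fin P.d} (hz : z ∉ cellBox K K₀ S)
    (hz' : z.shift ν ∈ cellBox K K₀ S) : (⟨ν, z.shift ν ν⟩ : Σ ν : Fin P.d, ZMod (P.sitesPerDir 0 ν)) ∈ faces K K₀ S := by
  rw [mem_cellBox] at hz hz'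
  push Not at hz
  obtain ⟨μ, hμ⟩ := hz
  have hμν : μ = ν := by
    by_contra h
    exact hμ (by have := hz' μ; rwa [cellOf, shift_apply_ne z h] at this)
  subst hμν
  refine mem_faces.2 ⟨hz' μ, Or.inr ?_⟩
  rw [shift_apply_self, add_sub_cancel_right]
  exact hμ

/-- **`hexF` for a box**: every bond of `exB □ P` (source in the box, target outside) has its source on a face slice in its own direction.
[cite: Balaban1983Higgs3, p.433] [cite: Balaban1982Higgs1, Prop. 2.1 p.611 l.1–2] -/
theorem exists_face_of_mem_exB (S : Fin P.d → Finset ℕ) (A : HiggsLattice.VecField P 0) :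
    ∀ b ∈ exB (cellBox K K₀ S) A, ∃ f ∈ faces K K₀ S, b.src f.1 = f.2 := by
  intro b hb
  obtain ⟨hs, ht, -⟩ := mem_exB.1 hb
  exact ⟨⟨b.dir, b.src b.dir⟩, face_of_shift_not_mem hs ht, rfl⟩

/-- **`henF` for a box**: every bond of `enB □ P` (source outside, target in the box) has its target on a face slice in its own direction.
[cite: Balaban1983Higgs3, p.433] [cite: Balaban1982Higgs1, Prop. 2.1 p.611 l.1–2] -/
theorem exists_face_of_mem_enB (S : Fin P.d → Finset ℕ) (A : HiggsLattice.VecField P 0) :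
    ∀ b ∈ enB (cellBox K K₀ S) A, ∃ f ∈ faces K K₀ S, b.tgt f.1 = f.2 := by
  intro b hb
  obtain ⟨hs, ht, -⟩ := mem_enB.1 hb
  exact ⟨⟨b.dir, b.tgt b.dir⟩, face_of_not_mem_shift_mem hs ht, rfl⟩

end Faces

/-! ## The size of the face family: at most two slices per cell index -/

section Card

open scoped Classical
open B1TorusCubeCover (half_pos nLab nLab_mul_half)

variable {K K₀ : ℕ}

/-- the slice parametrisation: cell `(ν, c)` and a side give the last site `(c+1)M − 1` or the first site `cM` of the cell.
[cite: Balaban1982Higgs1, Prop. 2.1 p.611 l.1–2] -/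
def sliceOf (K K₀ : ℕ) (g : (Σ _ν : Fin P.d, ℕ) × Bool) : Σ ν : Fin P.d, ZMod (P.sitesPerDir 0 ν) :=
  ⟨g.1.1, ((if g.2 then (g.1.2 + 1) * half P K K₀ - 1 else g.1.2 * half P K K₀ : ℕ) : ZMod (P.sitesPerDir 0 g.1.1))⟩

/-- Every face slice is the first or the last site of a cell of the box (`K ≤ K_P`, `K₀ ∣ M_P`, `K₀ ≥ 1`).
[cite: Balaban1982Higgs1, Prop. 2.1 p.611 l.1–2, (1.2) p.604] -/
theorem faces_subset_image (hK : K ≤ P.K) (hK₀ : K₀ ∣ P.M) (hK₀1 : 1 ≤ K₀) (S : Fin P.d → Finset ℕ) :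
    faces K K₀ S ⊆ ((Finset.univ.sigma S) ×ˢ (Finset.univ : Finset Bool)).image (sliceOf (P := P) K K₀) := by
  intro f hf
  obtain ⟨hc, hside⟩ := mem_faces.1 hf
  obtain ⟨ν, r⟩ := f
  set h := half P K K₀ with hh
  set c := r.val / h with hcdef
  have hpos : 0 < h := half_pos hK₀1
  have hn : h * nLab P K K₀ ν = P.sitesPerDir 0 ν := by rw [Nat.mul_comm]; exact nLab_mul_half hK hK₀ ν
  have hrn : r.val < P.sitesPerDir 0 ν := ZMod.val_lt r
  have hdm : h * c + r.val % h = r.val := Nat.div_add_mod r.val h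
  have hml : r.val % h < h := Nat.mod_lt _ hpos
  have hA : h * (c + 1) = h * c + h := Nat.mul_succ h c
  have hclt : c < nLab P K K₀ ν := by
    by_contra hle
    rw [not_lt] at hle
    have : h * nLab P K K₀ ν ≤ h * c := Nat.mul_le_mul_left h hle
    omega
  have hB : h * (c + 1) ≤ h * nLab P K K₀ ν := Nat.mul_le_mul_left h hclt
  have hn2 : 2 ≤ P.sitesPerDir 0 ν := by
    have h2 := B1TorusCubeCover.two_le_nLab hK hK₀ hK₀1 ν
    have : h * 2 ≤ h * nLab P K K₀ ν := Nat.mul_le_mul_left h h2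
    omega
  haveI : Fact (1 < P.sitesPerDir 0 ν) := ⟨by omega⟩
  rw [Finset.mem_image]
  rcases hside with hex | hen
  · -- exit: `r` is the last site of cell `c`
    refine ⟨⟨⟨ν, c⟩, true⟩, Finset.mem_product.2 ⟨Finset.mem_sigma.2 ⟨Finset.mem_univ _, hc⟩, Finset.mem_univ _⟩, ?_⟩
    have hmod : r.val % h = h - 1 := by
      by_contra hne
      have hr1 : r.val + 1 < P.sitesPerDir 0 ν := by omega
      have hval : (r + 1).val = r.val + 1 := by
        rw [ZMod.val_add, ZMod.val_one, Nat.mod_eq_of_lt hr1]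
      apply hex
      rw [hval]
      have : (r.val + 1) / h = c :=
        Nat.div_eq_of_lt_le (by rw [Nat.mul_comm]; omega) (by rw [Nat.mul_comm]; omega)
      rw [this]; exact hc
    simp only [sliceOf, if_true]
    congr 1
    have hv : r.val = (c + 1) * h - 1 := by rw [Nat.mul_comm]; omega
    rw [← hv, ZMod.natCast_zmod_val]
  · -- entry: `r` is the first site of cell `c`
    refine ⟨⟨⟨ν, c⟩, false⟩, Finset.mem_product.2 ⟨Finset.mem_sigma.2 ⟨Finset.mem_univ _, hc⟩, Finset.mem_univ _⟩, ?_⟩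
    have hmod : r.val % h = 0 := by
      by_contra hne
      have h1 : 1 ≤ r.val := by omega
      have hval : (r - 1).val = r.val - 1 := by
        rw [ZMod.val_sub (by rw [ZMod.val_one]; exact h1), ZMod.val_one]
      apply hen
      rw [hval]
      have : (r.val - 1) / h = c :=
        Nat.div_eq_of_lt_le (by rw [Nat.mul_comm]; omega) (by rw [Nat.mul_comm]; omega)
      rw [this]; exact hc
    simp only [sliceOf, Bool.false_eq_true, if_false]
    congr 1
    have hv : r.val = c * h := by rw [Nat.mul_comm]; omega
    rw [← hv, ZMod.natCast_zmod_val]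

/-- **The face family of a cell-product box has at most two slices per cell index**: `|faces| ≤ 2·Σ_ν|S_ν|` (so `≤ 2d·(cells per side)`;
for the located Leibniz row this makes the face constant of `holder_row_collar_le` independent of the volume).
[cite: Balaban1982Higgs1, Prop. 2.1 p.611 l.1–2] [cite: Balaban1983Higgs3, p.433] -/
theorem card_faces_le (hK : K ≤ P.K) (hK₀ : K₀ ∣ P.M) (hK₀1 : 1 ≤ K₀) (S : Fin P.d → Finset ℕ) :
    (faces K K₀ S).card ≤ 2 * ∑ ν : Fin P.d, (S ν).card := by
  refine (Finset.card_le_card (faces_subset_image hK hK₀ hK₀1 S)).trans (Finset.card_image_le.trans ?_)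
  rw [Finset.card_product, Finset.card_sigma, Finset.card_univ, Fintype.card_bool, mul_comm]

end Card

end Literature.MathematicalPhysics.QuantumFieldTheory.Balaban1983to89.B3Op116CollarBoxFaces

end
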